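import Mathlib.Analysis.SpecialFunctions.Log.Base
import Mathlib.Analysis.SpecialFunctions.Pow.Real
import HarnessLib

/-!
# Fluid computer — support: the dyadic optimisation behind the palinstrophy clock (pure real analysis)

HONEST FRAMING (cell `pub-fluidc`, verbatim): *low prior, high value-of-information experiment on Tao's
machine paradigm; NOT a claim that NS blows up.* Support file of `PalinstrophyClock` (L53′); no fluid content.

* `dyadic_optimisation` — if `a ≤ α 2^{3J/2} + β 2^{−J/2} √d` for EVERY `J ∈ ℤ`, with `a, β > 0` and `α, d ≥ 0`, then
  `a^{8/3} ≤ 16 β² α^{2/3} d`: for `α > 0` choose `J = ⌊log₂ (a/2α)^{2/3}⌋`, so that the head `α 2^{3J/2}` is at most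
  `a/2` while `2^J > (a/2α)^{2/3}/2`; for `α = 0` no `d` satisfies the hypothesis (let `J → ∞`).

0 sorry; no definitions.
-/

noncomputable section

open Set

namespace Summit.NavierStokesRegularity.FluidComputer.DyadicOptimisation

/-- **Dyadic optimisation** (real bookkeeping): if `a ≤ α 2^{3J/2} + β 2^{−J/2} √d` for EVERY `J ∈ ℤ`, with `a, β > 0`
and `α, d ≥ 0`, then `a^{8/3} ≤ 16 β² α^{2/3} d` (for `α > 0` choose `J = ⌊log₂ (a/2α)^{2/3}⌋`, so that the head is at most
`a/2`; for `α = 0` no `d` can satisfy the hypothesis, by `J → ∞`). [folklore] -/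
theorem dyadic_optimisation {a α β d : ℝ} (ha : 0 < a) (hα : 0 ≤ α) (hβ : 0 < β) (hd : 0 ≤ d)
    (h : ∀ J : ℤ, a ≤ α * (2 : ℝ) ^ ((3 / 2 : ℝ) * J) + β * (2 : ℝ) ^ (-(J : ℝ) / 2) * Real.sqrt d) :
    a ^ (8 / 3 : ℝ) ≤ 16 * β ^ 2 * α ^ (2 / 3 : ℝ) * d := by
  rcases hα.eq_or_lt with hα0 | hαpos
  · -- `α = 0`: the hypothesis fails for large `J`
    exfalso
    obtain ⟨n, hn⟩ := pow_unbounded_of_one_lt (β * Real.sqrt d / a) (by norm_num : (1 : ℝ) < 2)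
    have hJ := h (2 * n)
    rw [← hα0, zero_mul, zero_add] at hJ
    push_cast at hJ
    have e : (2 : ℝ) ^ (-(2 * (n : ℝ)) / 2) = ((2 : ℝ) ^ n)⁻¹ := by
      rw [← Real.rpow_natCast, ← Real.rpow_neg (by norm_num : (0 : ℝ) ≤ 2)]
      congr 1
      ring
    rw [e] at hJ
    have h2n : (0 : ℝ) < 2 ^ n := by positivity
    have hJ' : a * 2 ^ n ≤ β * Real.sqrt d := by
      rw [show β * ((2 : ℝ) ^ n)⁻¹ * Real.sqrt d = β * Real.sqrt d / 2 ^ n by ring] at hJ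
      rwa [le_div_iff₀ h2n] at hJ
    rw [div_lt_iff₀ ha, show (2 : ℝ) ^ n * a = a * 2 ^ n by ring] at hn
    exact absurd (hJ'.trans_lt hn) (lt_irrefl _)
  · -- `α > 0`: choose the level
    set x : ℝ := (a / (2 * α)) ^ (2 / 3 : ℝ) with hx
    have hx0 : 0 < x := by positivity
    set J : ℤ := ⌊Real.logb 2 x⌋ with hJdef
    have h2J : (2 : ℝ) ^ (J : ℝ) ≤ x := by
      calc (2 : ℝ) ^ (J : ℝ) ≤ (2 : ℝ) ^ Real.logb 2 x :=
            Real.rpow_le_rpow_of_exponent_le (by norm_num) (Int.floor_le _)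
        _ = x := Real.rpow_logb two_pos (by norm_num) hx0
    have hxJ : x < (2 : ℝ) ^ ((J : ℝ) + 1) := by
      calc x = (2 : ℝ) ^ Real.logb 2 x := (Real.rpow_logb two_pos (by norm_num) hx0).symm
        _ < (2 : ℝ) ^ ((J : ℝ) + 1) :=
            Real.rpow_lt_rpow_of_exponent_lt (by norm_num) (Int.lt_floor_add_one _)
    -- head ≤ a/2
    have hhead : α * (2 : ℝ) ^ ((3 / 2 : ℝ) * J) ≤ a / 2 := by
      have h1 : (2 : ℝ) ^ ((3 / 2 : ℝ) * J) = ((2 : ℝ) ^ (J : ℝ)) ^ (3 / 2 : ℝ) := by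
        rw [← Real.rpow_mul (by norm_num)]
        congr 1
        ring
      have h2 : ((2 : ℝ) ^ (J : ℝ)) ^ (3 / 2 : ℝ) ≤ x ^ (3 / 2 : ℝ) :=
        Real.rpow_le_rpow (by positivity) h2J (by norm_num)
      have h3 : x ^ (3 / 2 : ℝ) = a / (2 * α) := by
        rw [hx, ← Real.rpow_mul (by positivity)]
        norm_num
      rw [h1]
      calc α * ((2 : ℝ) ^ (J : ℝ)) ^ (3 / 2 : ℝ) ≤ α * (a / (2 * α)) := by
            rw [← h3]; exact mul_le_mul_of_nonneg_left h2 hα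
        _ = a / 2 := by field_simp
    -- hence the tail is ≥ a/2
    have htail : a / 2 ≤ β * (2 : ℝ) ^ (-(J : ℝ) / 2) * Real.sqrt d := by linarith [h J]
    -- square: `(a/2)² ≤ β² 2^{−J} d`
    have hpos : 0 ≤ β * (2 : ℝ) ^ (-(J : ℝ) / 2) := by positivity
    have hsq : (a / 2) ^ 2 ≤ β ^ 2 * (2 : ℝ) ^ (-(J : ℝ)) * d := by
      have e : (β * (2 : ℝ) ^ (-(J : ℝ) / 2) * Real.sqrt d) ^ 2 = β ^ 2 * (2 : ℝ) ^ (-(J : ℝ)) * d := by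
        rw [mul_pow, mul_pow, Real.sq_sqrt hd, ← Real.rpow_natCast ((2 : ℝ) ^ (-(J : ℝ) / 2)),
          ← Real.rpow_mul (by norm_num)]
        norm_num
      rw [← e]
      exact pow_le_pow_left₀ (by positivity) htail 2
    -- `2^{J} > x/2`
    have h2Jx : x / 2 < (2 : ℝ) ^ (J : ℝ) := by
      rw [Real.rpow_add_one (by norm_num)] at hxJ
      linarith
    have h2negJ : (2 : ℝ) ^ (-(J : ℝ)) = ((2 : ℝ) ^ (J : ℝ))⁻¹ := Real.rpow_neg (by norm_num) _
    -- combine: `(a/2)² ≤ β² d / 2^J < β² d · 2/x`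
    have h2Jpos : 0 < (2 : ℝ) ^ (J : ℝ) := by positivity
    have hmain : (a / 2) ^ 2 * (x / 2) ≤ β ^ 2 * d := by
      have h1 : (a / 2) ^ 2 * (2 : ℝ) ^ (J : ℝ) ≤ β ^ 2 * d := by
        rw [h2negJ] at hsq
        calc (a / 2) ^ 2 * (2 : ℝ) ^ (J : ℝ) ≤ β ^ 2 * ((2 : ℝ) ^ (J : ℝ))⁻¹ * d * (2 : ℝ) ^ (J : ℝ) :=
              mul_le_mul_of_nonneg_right hsq h2Jpos.le
          _ = β ^ 2 * d := by field_simp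
      exact le_trans (mul_le_mul_of_nonneg_left h2Jx.le (by positivity)) h1
    -- `x = a^{2/3} / (2α)^{2/3}` and `(2α)^{2/3} ≤ 2 α^{2/3}`
    have hx' : x = a ^ (2 / 3 : ℝ) / (2 * α) ^ (2 / 3 : ℝ) := by
      rw [hx, Real.div_rpow ha.le (by positivity)]
    have h2α : (2 * α) ^ (2 / 3 : ℝ) ≤ 2 * α ^ (2 / 3 : ℝ) := by
      rw [Real.mul_rpow (by norm_num) hα]
      refine mul_le_mul_of_nonneg_right ?_ (by positivity)
      calc (2 : ℝ) ^ (2 / 3 : ℝ) ≤ (2 : ℝ) ^ (1 : ℝ) := Real.rpow_le_rpow_of_exponent_le (by norm_num) (by norm_num)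
        _ = 2 := Real.rpow_one _
    have ha83 : a ^ (8 / 3 : ℝ) = a ^ 2 * a ^ (2 / 3 : ℝ) := by
      rw [← Real.rpow_natCast a 2, ← Real.rpow_add ha]
      norm_num
    have hα23 : 0 < α ^ (2 / 3 : ℝ) := Real.rpow_pos_of_pos hαpos _
    have h2α' : 0 < (2 * α) ^ (2 / 3 : ℝ) := Real.rpow_pos_of_pos (by positivity) _
    -- `(a/2)² (x/2) = a² a^{2/3} / (8 (2α)^{2/3}) ≥ a^{8/3}/(16 α^{2/3})`
    have hlow : a ^ (8 / 3 : ℝ) / (16 * α ^ (2 / 3 : ℝ)) ≤ (a / 2) ^ 2 * (x / 2) := by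
      rw [hx', ha83]
      rw [div_le_iff₀ (by positivity)]
      have e : (a / 2) ^ 2 * (a ^ (2 / 3 : ℝ) / (2 * α) ^ (2 / 3 : ℝ) / 2) * (16 * α ^ (2 / 3 : ℝ)) =
          a ^ 2 * a ^ (2 / 3 : ℝ) * (2 * α ^ (2 / 3 : ℝ) / (2 * α) ^ (2 / 3 : ℝ)) := by
        field_simp
        ring
      rw [e]
      have hge : 1 ≤ 2 * α ^ (2 / 3 : ℝ) / (2 * α) ^ (2 / 3 : ℝ) := by
        rw [le_div_iff₀ h2α', one_mul]
        exact h2α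
      calc a ^ 2 * a ^ (2 / 3 : ℝ) = a ^ 2 * a ^ (2 / 3 : ℝ) * 1 := (mul_one _).symm
        _ ≤ a ^ 2 * a ^ (2 / 3 : ℝ) * (2 * α ^ (2 / 3 : ℝ) / (2 * α) ^ (2 / 3 : ℝ)) :=
            mul_le_mul_of_nonneg_left hge (by positivity)
    have hfin : a ^ (8 / 3 : ℝ) / (16 * α ^ (2 / 3 : ℝ)) ≤ β ^ 2 * d := hlow.trans hmain
    rw [div_le_iff₀ (by positivity)] at hfin
    calc a ^ (8 / 3 : ℝ) ≤ β ^ 2 * d * (16 * α ^ (2 / 3 : ℝ)) := hfin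
      _ = 16 * β ^ 2 * α ^ (2 / 3 : ℝ) * d := by ring

end Summit.NavierStokesRegularity.FluidComputer.DyadicOptimisation

end
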